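import Summits.KontsevichZagierPeriods.KontsevichZagierPeriods.Theorems.SymplecticScissorsTypeAGenerationStubRoomStepCongruence
import Summits.KontsevichZagierPeriods.KontsevichZagierPeriods.Theorems.SymplecticScissorsTypeAGenerationStubSubstRoom
import Summits.KontsevichZagierPeriods.KontsevichZagierPeriods.Theorems.SymplecticScissorsTypeAGenerationStubRestrCOneAux

/-!
# `TypeAGeneration` (stmt-KontsevichZagierPeriods-18392), line `Sketch`, stub `stub_roomLemma_of` — part 1
(auxiliary stub `stub_roomLemma_ofAux`): bookkeeping helpers and the iterated room step in one direction

Support file for the registered stub `stub_roomLemma_of` (S6, the ROOM LEMMA of the radius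
amplification engine) of the crux `TypeAGeneration` (route SymplecticScissors, line `Sketch` = card
stokes-compiler), on top of the landed steps S2–S4
(`SymplecticScissorsTypeAGenerationStub{RoomStepCongruence,SubstRoom,RestrCOneAux}.lean`, whose
weight/scalar helpers are reused).

* closure of the `k`-span along `σ` under rational scalars (`s6_ratCast_smul_mem_kSpan`);
* anisotropic weighted summability `Σ ‖F_a‖ ρ^a < ∞`: change of weights on unused variables,
  monotonicity, scalars, sums, and the passage to an isotropic radius (`s6_ws_*`, `s6_iso`);
* `s6_iter`: `s` room steps in direction `i` with fresh variables `N, N+1, …, N+s−1`: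
  `D₀ ≡ (1−μ)^s · D_s + Acc_s` modulo the span of type (a), with `D_s` of weight `ρᵢ (1−μ)^{-s}`
  at `i` and `Acc_s` of weight `(ρᵢ − 1)/μ` at the fresh variables.

No definition is introduced (the hypotheses S2–S5 are carried as section variables, verbatim the
registered statements). References: Ayoub 2015 Conj. 1.1, Rem. 1.2, Rem. 1.5; Fresán 2024 Rem. 3.7.
-/

noncomputable section

-- `Summit.KontsevichZagierPeriods.KontsevichZagierPeriods.…` is the tree's mandated layout (single-conjunct summit).
set_option linter.dupNamespace false

namespace Summit.KontsevichZagierPeriods.KontsevichZagierPeriods.TypeAGenerationLine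

open Finsupp MvPowerSeries
open Literature.NumberTheory.Transcendental
open Literature.NumberTheory.Transcendental.AyoubRel
open Summit.KontsevichZagierPeriods.KontsevichZagierPeriods.Theses.SymplecticScissors (TypeAGeneration)

/-! ## Span and variables helpers -/

section SpanHelpers

variable {k : Type} [Field k] (σ : k →+* ℂ)

/-- `0` lies in every `k`-span (the empty combination). [folklore] -/
theorem s6_zero_mem_kSpan {M : Type*} [AddCommGroup M] [Module ℂ M] (S : Set M) :
    (0 : M) ∈ kSpan σ S :=
  ⟨0, Fin.elim0, Fin.elim0, fun j => Fin.elim0 j, by simp⟩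

/-- The `k`-span along `σ` is stable under rational scalars (`q = σ(q)`). [folklore] -/
theorem s6_ratCast_smul_mem_kSpan {M : Type*} [AddCommGroup M] [Module ℂ M] {S : Set M} (q : ℚ)
    {x : M} (hx : x ∈ kSpan σ S) : ((q : ℚ) : ℂ) • x ∈ kSpan σ S := by
  obtain ⟨n, c, s, hs, rfl⟩ := hx
  refine ⟨n, fun j => (q : k) * c j, s, hs, ?_⟩
  rw [Finset.smul_sum]
  refine Finset.sum_congr rfl fun j _ => ?_
  rw [map_mul, map_ratCast, smul_smul]

omit [Field k] in
/-- A sum uses a variable only if a summand does. [folklore] -/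
theorem s6_usesVar_add {F G : CSeries} {l : ℕ} (h : UsesVar (F + G) l) : UsesVar F l ∨ UsesVar G l := by
  obtain ⟨a, hal, ha⟩ := h
  rw [map_add] at ha
  by_cases hF : coeff a F = 0
  · right
    rw [hF, zero_add] at ha
    exact ⟨a, hal, ha⟩
  · exact Or.inl ⟨a, hal, hF⟩

omit [Field k] in
/-- A series depending only on `z_0, …, z_{N-1}` uses only variables `< N`. [folklore] -/
theorem s6_lt_of_usesVar {F : CSeries} {N : ℕ} (hN : DependsOnlyOnLT F N) {l : ℕ} (h : UsesVar F l) :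
    l < N := by
  by_contra hl
  obtain ⟨a, hal, ha⟩ := h
  exact ha (hN a ⟨l, not_lt.mp hl, hal⟩)

omit [Field k] in
/-- Conversely, a bound on the used variables gives `DependsOnlyOnLT`. [folklore] -/
theorem s6_dependsOnlyOnLT_of_usesVar {F : CSeries} {N : ℕ} (hN : ∀ l, UsesVar F l → l < N) :
    DependsOnlyOnLT F N := by
  rintro a ⟨l, hl, hal⟩
  by_contra ha
  exact absurd (hN l ⟨a, hal, ha⟩) (not_lt.mpr hl)

/-- Rational multiples stay in `𝒪_{k-alg}(𝔻̄^∞)`. [folklore] -/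
theorem s6_ratCast_smul_mem_Oan (q : ℚ) {F : CSeries} (hF : F ∈ Oan σ) : ((q : ℚ) : ℂ) • F ∈ Oan σ :=
  smul_mem_Oan σ (s2_ratCast_algebraic σ q) hF

end SpanHelpers

/-! ## Anisotropic weighted summability -/

section Weights

/-- Weights may be changed on variables the series does not use. [folklore] -/
theorem s6_ws_congr {F : CSeries} {ρ ρ' : ℕ → ℝ} (h : ∀ l, UsesVar F l → ρ l = ρ' l)
    (hs : Summable fun a : ℕ →₀ ℕ => ‖coeff a F‖ * a.prod fun l n => ρ l ^ n) :
    Summable fun a : ℕ →₀ ℕ => ‖coeff a F‖ * a.prod fun l n => ρ' l ^ n := by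
  refine hs.congr fun a => ?_
  by_cases ha : coeff a F = 0
  · rw [ha, norm_zero, zero_mul, zero_mul]
  · rw [s3_wprod_congr (w := ρ) (w' := ρ') fun l hl => h l ⟨a, Finsupp.mem_support_iff.mp hl, ha⟩]

/-- Smaller non-negative weights stay summable. [folklore] -/
theorem s6_ws_mono {F : CSeries} {ρ ρ' : ℕ → ℝ} (h0 : ∀ l, 0 ≤ ρ' l) (hle : ∀ l, ρ' l ≤ ρ l)
    (hs : Summable fun a : ℕ →₀ ℕ => ‖coeff a F‖ * a.prod fun l n => ρ l ^ n) :
    Summable fun a : ℕ →₀ ℕ => ‖coeff a F‖ * a.prod fun l n => ρ' l ^ n := by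
  refine hs.of_nonneg_of_le (fun a => mul_nonneg (norm_nonneg _) (s3_wprod_nonneg h0 a)) fun a => ?_
  refine mul_le_mul_of_nonneg_left ?_ (norm_nonneg _)
  unfold Finsupp.prod
  exact Finset.prod_le_prod (fun l _ => pow_nonneg (h0 l) _) fun l _ => pow_le_pow_left₀ (h0 l) (hle l) _

/-- Scalars preserve weighted summability. [folklore] -/
theorem s6_ws_smul {F : CSeries} {ρ : ℕ → ℝ} (c : ℂ)
    (hs : Summable fun a : ℕ →₀ ℕ => ‖coeff a F‖ * a.prod fun l n => ρ l ^ n) :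
    Summable fun a : ℕ →₀ ℕ => ‖coeff a (c • F)‖ * a.prod fun l n => ρ l ^ n := by
  refine (hs.mul_left ‖c‖).congr fun a => ?_
  rw [MvPowerSeries.coeff_smul, norm_mul, mul_assoc]

/-- Sums preserve weighted summability (non-negative weights). [folklore] -/
theorem s6_ws_add {F G : CSeries} {ρ : ℕ → ℝ} (h0 : ∀ l, 0 ≤ ρ l)
    (hF : Summable fun a : ℕ →₀ ℕ => ‖coeff a F‖ * a.prod fun l n => ρ l ^ n)
    (hG : Summable fun a : ℕ →₀ ℕ => ‖coeff a G‖ * a.prod fun l n => ρ l ^ n) :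
    Summable fun a : ℕ →₀ ℕ => ‖coeff a (F + G)‖ * a.prod fun l n => ρ l ^ n := by
  refine (hF.add hG).of_nonneg_of_le (fun a => mul_nonneg (norm_nonneg _) (s3_wprod_nonneg h0 a))
    fun a => ?_
  rw [map_add, ← add_mul]
  exact mul_le_mul_of_nonneg_right (norm_add_le _ _) (s3_wprod_nonneg h0 a)

/-- The zero series is weighted summable. [folklore] -/
theorem s6_ws_zero (ρ : ℕ → ℝ) :
    Summable fun a : ℕ →₀ ℕ => ‖coeff a (0 : CSeries)‖ * a.prod fun l n => ρ l ^ n :=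
  summable_zero.congr fun a => by rw [map_zero, norm_zero, zero_mul]

/-- **From anisotropic to isotropic**: if `Σ ‖P_a‖ ρ^a < ∞` and `0 ≤ r ≤ ρ_l` for every variable
`l < N`, all variables of `P` being `< N`, then `Σ ‖P_a‖ r^{|a|} < ∞`. [folklore] -/
theorem s6_iso {P : CSeries} {ρ : ℕ → ℝ} {N : ℕ} (hN : ∀ l, UsesVar P l → l < N) {r : ℝ}
    (hr0 : 0 ≤ r) (hr : ∀ l, l < N → r ≤ ρ l)
    (hs : Summable fun a : ℕ →₀ ℕ => ‖coeff a P‖ * a.prod fun l n => ρ l ^ n) :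
    Summable fun a : ℕ →₀ ℕ => ‖coeff a P‖ * r ^ degree a := by
  refine hs.of_nonneg_of_le (fun a => by positivity) fun a => ?_
  by_cases ha : coeff a P = 0
  · rw [ha, norm_zero, zero_mul, zero_mul]
  · rw [← s4_prod_const_pow]
    refine mul_le_mul_of_nonneg_left ?_ (norm_nonneg _)
    unfold Finsupp.prod
    refine Finset.prod_le_prod (fun l _ => pow_nonneg hr0 _) fun l hl => ?_
    exact pow_le_pow_left₀ hr0 (hr l (hN l ⟨a, Finsupp.mem_support_iff.mp hl, ha⟩)) _

/-- An element of `𝒪_{k-alg}(𝔻̄^∞)` has constant weights `r > 1`. [folklore] -/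
theorem s6_ws_of_mem_Oan {k : Type} [Field k] (σ : k →+* ℂ) {F : CSeries} (hF : F ∈ Oan σ) :
    ∃ r : ℝ, 1 < r ∧ Summable fun a : ℕ →₀ ℕ => ‖coeff a F‖ * a.prod fun _ n => r ^ n := by
  obtain ⟨r, hr, hs⟩ := hF.2.1
  exact ⟨r, hr, hs.congr fun a => by rw [s4_prod_const_pow]⟩

end Weights

/-! ## The iterated room step in one direction -/

section Iter

variable
  (h2 : ∀ (k : Type) [Field k] [CharZero k] (σ : k →+* ℂ) (F : CSeries), F ∈ Oan σ →
      ∀ (i j : ℕ), i ≠ j → ¬ UsesVar F j → ∀ (μ : ℚ),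
        MvPowerSeries.subst
            (fun l : ℕ => if l = i then (X i - C ((μ : ℚ) : ℂ) * (X i * X j) : CSeries) else X l) F ∈ Oan σ →
        F - ((((1 - μ : ℚ) : ℂ)) • MvPowerSeries.rescale (Function.update (1 : ℕ → ℂ) i ((1 - μ : ℚ) : ℂ)) F
              + ((μ : ℚ) : ℂ) • restrC i 1
                  (MvPowerSeries.subst
                    (fun l : ℕ => if l = i then (X i - C ((μ : ℚ) : ℂ) * (X i * X j) : CSeries) else X l) F)) ∈
          kSpan σ {x : CSeries | ∃ G ∈ Oan σ, ∃ n : ℕ, x = relAC n G})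
  (h3 : ∀ (k : Type) [Field k] [CharZero k] (σ : k →+* ℂ) (F : CSeries), F ∈ Oan σ →
      ∀ (ρ : ℕ → ℝ), (∀ l, 1 < ρ l) →
        Summable (fun a : ℕ →₀ ℕ => ‖MvPowerSeries.coeff a F‖ * a.prod fun l n => ρ l ^ n) →
      ∀ (i j : ℕ), i ≠ j → ¬ UsesVar F j →
      ∀ (μ : ℚ), 0 < μ → ((μ : ℝ) < ρ i - 1) →
        MvPowerSeries.subst
            (fun l : ℕ => if l = i then (X i - C ((μ : ℚ) : ℂ) * (X i * X j) : CSeries) else X l) F ∈ Oan σ ∧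
        (∀ θi θj : ℝ, 0 ≤ θi → 0 ≤ θj → θi * (1 + (μ : ℝ) * θj) ≤ ρ i →
          Summable (fun a : ℕ →₀ ℕ =>
            ‖MvPowerSeries.coeff a (MvPowerSeries.subst
              (fun l : ℕ => if l = i then (X i - C ((μ : ℚ) : ℂ) * (X i * X j) : CSeries) else X l) F)‖ *
              a.prod fun l n => (Function.update (Function.update ρ i θi) j θj) l ^ n)) ∧
        (∀ l : ℕ, UsesVar (MvPowerSeries.subst
            (fun l : ℕ => if l = i then (X i - C ((μ : ℚ) : ℂ) * (X i * X j) : CSeries) else X l) F) l →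
          l = j ∨ UsesVar F l))
  (h4 : ∀ (k : Type) [Field k] [CharZero k] (σ : k →+* ℂ) (G : CSeries), G ∈ Oan σ → ∀ (i : ℕ),
      restrC i 1 G ∈ Oan σ ∧ ¬ UsesVar (restrC i 1 G) i ∧
      (∀ l : ℕ, UsesVar (restrC i 1 G) l → UsesVar G l) ∧
      (∀ ρ : ℕ → ℝ, (∀ l, 1 ≤ ρ l) →
        Summable (fun a : ℕ →₀ ℕ => ‖MvPowerSeries.coeff a G‖ * a.prod fun l n => ρ l ^ n) →
        Summable (fun a : ℕ →₀ ℕ =>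
          ‖MvPowerSeries.coeff a (restrC i 1 G)‖ * a.prod fun l n => ρ l ^ n)))
  (h5 : ∀ (k : Type) [Field k] [CharZero k] (σ : k →+* ℂ) (F : CSeries), F ∈ Oan σ →
      ∀ (ρ : ℕ → ℝ), (∀ l, 1 < ρ l) →
        Summable (fun a : ℕ →₀ ℕ => ‖MvPowerSeries.coeff a F‖ * a.prod fun l n => ρ l ^ n) →
      ∀ (i : ℕ) (μ : ℚ), 0 < μ → μ < 1 →
        MvPowerSeries.rescale (Function.update (1 : ℕ → ℂ) i ((1 - μ : ℚ) : ℂ)) F ∈ Oan σ ∧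
        Summable (fun a : ℕ →₀ ℕ =>
          ‖MvPowerSeries.coeff a (MvPowerSeries.rescale (Function.update (1 : ℕ → ℂ) i ((1 - μ : ℚ) : ℂ)) F)‖ *
            a.prod fun l n => (Function.update ρ i (ρ i / (1 - (μ : ℝ)))) l ^ n) ∧
        (∀ l : ℕ, UsesVar (MvPowerSeries.rescale (Function.update (1 : ℕ → ℂ) i ((1 - μ : ℚ) : ℂ)) F) l →
          UsesVar F l))

variable {k : Type} [Field k] [CharZero k] (σ : k →+* ℂ)

include h2 h3 h4 h5 in
/-- **Iterated room step in direction `i`.** Starting from `D₀ ∈ 𝒪_{k-alg}(𝔻̄^∞)` with weights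
`ρ > 1`, variables `< N`, `i < N`, and a rational `0 < μ < 1`, `μ < ρᵢ − 1`: after `s` room steps
(fresh variables `N, …, N+s−1`) one has `D₀ − ((1−μ)^s • D + Acc) ∈ ⟨a⟩_k` with `D, Acc ∈
𝒪_{k-alg}(𝔻̄^∞)`, `D` of weights `ρ[i ↦ ρᵢ (1−μ)^{-s}]` using only variables of `D₀`, and `Acc` of
weights `(ρᵢ − 1)/μ` at the variables `≥ N`, using only variables of `D₀` other than `i` and the
fresh ones. [cite: Ayoub2015, Rem. 1.5] -/
theorem s6_iter (D₀ : CSeries) (hD₀ : D₀ ∈ Oan σ) (ρ : ℕ → ℝ) (hρ : ∀ l, 1 < ρ l)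
    (hws : Summable fun a : ℕ →₀ ℕ => ‖coeff a D₀‖ * a.prod fun l n => ρ l ^ n)
    (N : ℕ) (hN : ∀ l, UsesVar D₀ l → l < N) (i : ℕ) (hi : i < N)
    (μ : ℚ) (hμ0 : 0 < μ) (hμ1 : μ < 1) (hμρ : (μ : ℝ) < ρ i - 1) (s : ℕ) :
    ∃ D Acc : CSeries, D ∈ Oan σ ∧ Acc ∈ Oan σ ∧
      (Summable fun a : ℕ →₀ ℕ => ‖coeff a D‖ *
          a.prod fun l n => (Function.update ρ i (ρ i / (1 - (μ : ℝ)) ^ s)) l ^ n) ∧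
      (∀ l, UsesVar D l → UsesVar D₀ l) ∧
      (Summable fun a : ℕ →₀ ℕ => ‖coeff a Acc‖ *
          a.prod fun l n => (fun l => if N ≤ l then (ρ i - 1) / (μ : ℝ) else ρ l) l ^ n) ∧
      (∀ l, UsesVar Acc l → (UsesVar D₀ l ∧ l ≠ i) ∨ (N ≤ l ∧ l < N + s)) ∧
      D₀ - ((((1 - μ : ℚ) : ℂ)) ^ s • D + Acc) ∈
        kSpan σ {x : CSeries | ∃ G ∈ Oan σ, ∃ n : ℕ, x = relAC n G} := by
  -- constants
  have hlam0 : (0 : ℝ) < 1 - (μ : ℝ) := by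
    have : (μ : ℝ) < 1 := by exact_mod_cast hμ1
    linarith
  have hlam1 : 1 - (μ : ℝ) ≤ 1 := by
    have : (0 : ℝ) < μ := by exact_mod_cast hμ0
    linarith
  have hρi1 : 1 < ρ i := hρ i
  have hμ0r : (0 : ℝ) < μ := by exact_mod_cast hμ0
  have hΘ1 : 1 < (ρ i - 1) / (μ : ℝ) := by
    rw [one_lt_div hμ0r]; linarith
  induction s with
  | zero =>
    refine ⟨D₀, 0, hD₀, zero_mem_Oan σ, ?_, fun l hl => hl, s6_ws_zero _, fun l hl =>
      absurd hl (not_usesVar_zero l), ?_⟩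
    · rw [pow_zero, div_one, Function.update_eq_self]
      exact hws
    · rw [pow_zero, one_smul, add_zero, sub_self]
      exact s6_zero_mem_kSpan σ _
  | succ s ih =>
    obtain ⟨D, Acc, hD, hAcc, hwsD, hvarD, hwsAcc, hvarAcc, hcong⟩ := ih
    -- current weights
    set ρs : ℕ → ℝ := Function.update ρ i (ρ i / (1 - (μ : ℝ)) ^ s) with hρs_def
    have hρsi : ρs i = ρ i / (1 - (μ : ℝ)) ^ s := by rw [hρs_def, Function.update_self]
    have hρsl : ∀ l, l ≠ i → ρs l = ρ l := fun l hl => by rw [hρs_def, Function.update_of_ne hl]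
    have hρi_le : ρ i ≤ ρs i := by
      rw [hρsi, le_div_iff₀ (pow_pos hlam0 s)]
      exact mul_le_of_le_one_right (zero_le_one.trans hρi1.le) (pow_le_one₀ hlam0.le hlam1)
    have hρs : ∀ l, 1 < ρs l := by
      intro l
      by_cases hl : l = i
      · rw [hl]; exact hρi1.trans_le hρi_le
      · rw [hρsl l hl]; exact hρ l
    have hμρs : (μ : ℝ) < ρs i - 1 := by linarith
    -- the fresh variable
    set j : ℕ := N + s with hj_def
    have hij : i ≠ j := by omega
    have hDj : ¬ UsesVar D j := fun h => by
      have := hN j (hvarD j h)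
      omega
    -- the three stubs
    obtain ⟨hT, hTw, hTvar⟩ := h3 k σ D hD ρs hρs hwsD i j hij hDj μ hμ0 hμρs
    have hstep := h2 k σ D hD i j hij hDj μ hT
    obtain ⟨hD', hwsD', hvarD'⟩ := h5 k σ D hD ρs hρs hwsD i μ hμ0 hμ1
    obtain ⟨hE, hEi, hEvar, hEw⟩ := h4 k σ _ hT i
    -- names for the pieces
    set T : CSeries := MvPowerSeries.subst
      (fun l : ℕ => if l = i then (X i - C ((μ : ℚ) : ℂ) * (X i * X j) : CSeries) else X l) D with hT_def
    set D' : CSeries := MvPowerSeries.rescale (Function.update (1 : ℕ → ℂ) i ((1 - μ : ℚ) : ℂ)) D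
      with hD'_def
    set E : CSeries := restrC i 1 T with hE_def
    -- weights of E
    set θs : ℝ := (ρs i - 1) / (μ : ℝ) with hθs_def
    have hθs1 : 1 < θs := by rw [hθs_def, one_lt_div hμ0r]; linarith
    have hΘθ : (ρ i - 1) / (μ : ℝ) ≤ θs := by
      rw [hθs_def]
      exact div_le_div_of_nonneg_right (by linarith) hμ0r.le
    have hTws : Summable fun a : ℕ →₀ ℕ => ‖coeff a T‖ *
        a.prod fun l n => (Function.update (Function.update ρs i 1) j θs) l ^ n := by
      refine hTw 1 θs zero_le_one (zero_le_one.trans hθs1.le) (le_of_eq ?_)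
      rw [hθs_def, one_mul, mul_div_cancel₀ _ hμ0r.ne']
      ring
    have hW1 : ∀ l, 1 ≤ (Function.update (Function.update ρs i 1) j θs) l := by
      intro l
      by_cases hlj : l = j
      · rw [hlj, Function.update_self]; exact hθs1.le
      · rw [Function.update_of_ne hlj]
        by_cases hli : l = i
        · rw [hli, Function.update_self]
        · rw [Function.update_of_ne hli]; exact (hρs l).le
    have hEws0 := hEw _ hW1 hTws
    -- lower the weight at `j` to `Θ`, then move to the target weights
    have hEws1 : Summable fun a : ℕ →₀ ℕ => ‖coeff a E‖ *
        a.prod fun l n => (Function.update (Function.update ρs i 1) j ((ρ i - 1) / (μ : ℝ))) l ^ n := by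
      refine s6_ws_mono (fun l => ?_) (fun l => ?_) hEws0
      · by_cases hlj : l = j
        · rw [hlj, Function.update_self]; exact zero_le_one.trans hΘ1.le
        · rw [Function.update_of_ne hlj]
          by_cases hli : l = i
          · rw [hli, Function.update_self]; exact zero_le_one
          · rw [Function.update_of_ne hli]; exact zero_le_one.trans (hρs l).le
      · by_cases hlj : l = j
        · rw [hlj, Function.update_self, Function.update_self]; exact hΘθ
        · rw [Function.update_of_ne hlj, Function.update_of_ne hlj]
    have hEws : Summable fun a : ℕ →₀ ℕ => ‖coeff a E‖ *
        a.prod fun l n => (fun l => if N ≤ l then (ρ i - 1) / (μ : ℝ) else ρ l) l ^ n := by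
      refine s6_ws_congr (fun l hl => ?_) hEws1
      have hli : l ≠ i := fun h => hEi (h ▸ hl)
      rcases hTvar l (hEvar l hl) with hlj | hlD
      · rw [hlj, Function.update_self, if_pos (by omega)]
      · have hlN : l < N := hN l (hvarD l hlD)
        have hlj : l ≠ j := by omega
        rw [Function.update_of_ne hlj, Function.update_of_ne hli, hρsl l hli, if_neg (by omega)]
    -- the new accumulator
    set c : ℂ := (((1 - μ : ℚ) : ℂ)) ^ s * ((μ : ℚ) : ℂ) with hc_def
    have hc : c = (((1 - μ) ^ s * μ : ℚ) : ℂ) := by rw [hc_def]; push_cast; ring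
    have hΘ0 : ∀ l, 0 ≤ (fun l => if N ≤ l then (ρ i - 1) / (μ : ℝ) else ρ l) l := by
      intro l
      simp only
      split_ifs
      · exact zero_le_one.trans hΘ1.le
      · exact zero_le_one.trans (hρ l).le
    refine ⟨D', c • E + Acc, hD', ?_, ?_, fun l hl => hvarD l (hvarD' l hl), ?_, ?_, ?_⟩
    · -- Acc' ∈ Oan
      refine add_mem_Oan σ ?_ hAcc
      rw [hc]
      exact s6_ratCast_smul_mem_Oan σ _ hE
    · -- weights of D'
      have hupd : Function.update ρs i (ρs i / (1 - (μ : ℝ))) =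
          Function.update ρ i (ρ i / (1 - (μ : ℝ)) ^ (s + 1)) := by
        rw [hρs_def, Function.update_idem, Function.update_self, pow_succ, div_div]
      rw [← hupd]
      exact hwsD'
    · -- weights of Acc'
      exact s6_ws_add hΘ0 (s6_ws_smul c hEws) hwsAcc
    · -- variables of Acc'
      intro l hl
      rcases s6_usesVar_add hl with hl | hl
      · have hlE : UsesVar E l := usesVar_of_smul hl
        have hli : l ≠ i := fun h => hEi (h ▸ hlE)
        rcases hTvar l (hEvar l hlE) with hlj | hlD
        · right; omega
        · exact Or.inl ⟨hvarD l hlD, hli⟩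
      · rcases hvarAcc l hl with h | h
        · exact Or.inl h
        · right; omega
    · -- the congruence
      have hid : D₀ - ((((1 - μ : ℚ) : ℂ)) ^ (s + 1) • D' + (c • E + Acc)) =
          (D₀ - ((((1 - μ : ℚ) : ℂ)) ^ s • D + Acc)) +
            (((1 - μ : ℚ) : ℂ)) ^ s • (D - ((((1 - μ : ℚ) : ℂ)) • D' + ((μ : ℚ) : ℂ) • E)) := by
        rw [hc_def]
        module
      rw [hid]
      refine kSpan_add σ hcong ?_
      have hq : (((1 - μ : ℚ) : ℂ)) ^ s = ((((1 - μ) ^ s : ℚ)) : ℂ) := by push_cast; ring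
      rw [hq]
      exact s6_ratCast_smul_mem_kSpan σ _ hstep

end Iter

/-! ## Registered form -/

/-- **Registered auxiliary stub** `stub_roomLemma_ofAux` (sub-goal of `stub_roomLemma_of`, crux
stmt-KontsevichZagierPeriods-18392): the passage from anisotropic weights to an isotropic radius —
if `Σ ‖P_a‖ ρ^a < ∞`, all variables of `P` are `< N` and `0 ≤ r ≤ ρ_l` for `l < N`, then
`Σ ‖P_a‖ r^{|a|} < ∞` (= `s6_iso`). [folklore] -/
theorem stub_roomLemma_ofAux :
    ∀ (P : CSeries) (ρ : ℕ → ℝ) (N : ℕ) (r : ℝ), (∀ l, UsesVar P l → l < N) → 0 ≤ r →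
      (∀ l, l < N → r ≤ ρ l) →
      Summable (fun a : ℕ →₀ ℕ => ‖MvPowerSeries.coeff a P‖ * a.prod fun l n => ρ l ^ n) →
      Summable (fun a : ℕ →₀ ℕ => ‖MvPowerSeries.coeff a P‖ * r ^ degree a) :=
  fun _ _ _ _ hN hr0 hr hs => s6_iso hN hr0 hr hs

end Summit.KontsevichZagierPeriods.KontsevichZagierPeriods.TypeAGenerationLine
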